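import Literature.RingTheory.HilbertSamuel.TangentConeChangeOfGenerators
import Literature.RingTheory.HilbertSamuel.TangentConeBaseChange
import Literature.AlgebraicGeometry.Resolution.AdicCompletionRegular
import Mathlib.RingTheory.AdicCompletion.LocalRing
import HarnessLib

/-!
# Hilbert–Samuel function, tangent cone and directrix of the completion:
# `H_{𝒪̂} = H_𝒪`, `J_{𝒪̂} = J_𝒪`, `e(𝒪̂) = e(𝒪)`, `ē(𝒪̂) = ē(𝒪)`

Topic: `Literature/RingTheory/HilbertSamuel`. CJS, LNM 2270, Lemma 2.27 (3) / Lemma 2.37 (2) with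
`X = X_0`, `x = x_0`, `d = 0`: for the completion `π : Spec 𝒪̂_{X,x} → Spec 𝒪_{X,x}` one has
`C_{x̂}(X̂) ≅ C_x(X)`, `H^{(0)}_{𝒪̂} = H^{(0)}_𝒪`, `Dir_{x̂} ≅ Dir_x`, `e_{x̂} = e_x` — the morphism
`𝒪 → 𝒪̂` is flat with `𝔪 𝒪̂ = 𝔪̂` and trivial residue field extension, i.e. quasi-étale in Bennett's
sense (Lemma 2.27 (1)). Everything is PROVED from `TangentConeBaseChange.lean` (CJS (2.4)) and
Mathlib's `AdicCompletion` API (`maximalIdeal_eq_map`, `residueField_map_bijective`,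
`flat_of_isNoetherian`, `spanFinrank_maximalIdeal_eq`):

* `hilbertFun_adicCompletion`, `hilbertSamuelFun_adicCompletion` — **`H^{(t)}_{Â} = H^{(t)}_A`**;
* `tangentConeIdeal_adicCompletion` — `J_{Â} = J_A · k̂[X]` for the images of generators of `𝔪`
  (`k̂ = k(Â) ≅ k(A)`);
* `directrixDim_tangentConeIdeal_adicCompletion`, **`dirDim_adicCompletion`** (`e(Â) = e(A)`),
  `dirDimOver_adicCompletion`, **`geomDirDim_adicCompletion`** (`ē(Â) = ē(A)`);
* also `ringKrullDim` (`AdicCompletionRegular.lean`) and `emb.dim` (Mathlib) agree, recorded as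
  `spanFinrank_maximalIdeal_adicCompletion`.

## References

* V. Cossart, U. Jannsen, S. Saito, *Desingularization: Invariants and Strategy*, LNM 2270
  (2020), Lemma 2.27 (1), (3); Lemma 2.37 (2). [CossartJannsenSaito2020]
-/

noncomputable section

open IsLocalRing MvPolynomial
open Literature.AlgebraicGeometry.Resolution Literature.RingTheory.MvPolynomial

namespace Literature.RingTheory.HilbertSamuel

universe u v

variable (A : Type u) [CommRing A] [IsLocalRing A] [IsNoetherianRing A]

/-- The completion of a noetherian local ring is noetherian (Stacks 0316, `AdicNoetherian.lean`),
as an instance for this file's statements. [cite: StacksProject, Tag 0316] -/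
instance isNoetherianRing_adicCompletion : IsNoetherianRing (AdicCompletion (maximalIdeal A) A) :=
  isNoetherianRing_adicCompletion_maximalIdeal A

/-- `𝔪 Â = 𝔪_Â` (Mathlib). [folklore] -/
theorem map_maximalIdeal_adicCompletion :
    (maximalIdeal A).map (algebraMap A (AdicCompletion (maximalIdeal A) A)) =
      maximalIdeal (AdicCompletion (maximalIdeal A) A) :=
  AdicCompletion.maximalIdeal_eq_map.symm

/-- `emb.dim Â = emb.dim A` (Mathlib `AdicCompletion.spanFinrank_maximalIdeal_eq`). [folklore] -/
theorem spanFinrank_maximalIdeal_adicCompletion :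
    (maximalIdeal (AdicCompletion (maximalIdeal A) A)).spanFinrank = (maximalIdeal A).spanFinrank :=
  AdicCompletion.spanFinrank_maximalIdeal_eq

/-- **`H^{(0)}_{Â} = H^{(0)}_A`**: `A → Â` is flat with `𝔪 Â = 𝔪_Â` (CJS Lemma 2.27 (1) for the
completion). [cite: CossartJannsenSaito2020, Lemma 2.27 (1)] -/
theorem hilbertFun_adicCompletion : hilbertFun (AdicCompletion (maximalIdeal A) A) = hilbertFun A :=
  hilbertFun_eq_of_flat_of_map_maximalIdeal_eq (map_maximalIdeal_adicCompletion A)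

/-- **`H^{(t)}_{Â} = H^{(t)}_A`** for all `t`. [cite: CossartJannsenSaito2020, Lemma 2.27 (1)] -/
theorem hilbertSamuelFun_adicCompletion (t : ℕ) :
    hilbertSamuelFun (AdicCompletion (maximalIdeal A) A) t = hilbertSamuelFun A t := by
  rw [hilbertSamuelFun, hilbertSamuelFun, hilbertFun_adicCompletion]

variable {A}

/-- **`J_{Â} = J_A · k̂[X]`**: the tangent cone ideal of `Â` with respect to the images of
generators `x` of `𝔪` is the extension of that of `A` along the residue field map
`k(A) → k(Â)` (an isomorphism) — `C(Â) ≅ C(A)`, CJS (2.4) / Lemma 2.27 (3) with `d = 0`.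
[cite: CossartJannsenSaito2020, Lemma 2.27 (3)] -/
theorem tangentConeIdeal_adicCompletion {e : ℕ} (x : Fin e → A)
    (hx : Ideal.span (Set.range x) = maximalIdeal A) :
    tangentConeIdeal (fun i => algebraMap A (AdicCompletion (maximalIdeal A) A) (x i))
        (span_range_algebraMap_eq (map_maximalIdeal_adicCompletion A) x hx) =
      (tangentConeIdeal x hx).map (MvPolynomial.map
        (ResidueField.map (algebraMap A (AdicCompletion (maximalIdeal A) A)))) :=
  tangentConeIdeal_eq_map (map_maximalIdeal_adicCompletion A) x hx

/-- **`e(k̂[X]/J_Â) = e(k[X]/J_A)`** for the images of generators of `𝔪` (the residue field map is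
bijective). [cite: CossartJannsenSaito2020, Lemma 2.27 (3)] -/
theorem directrixDim_tangentConeIdeal_adicCompletion {e : ℕ} (x : Fin e → A)
    (hx : Ideal.span (Set.range x) = maximalIdeal A) :
    directrixDim (tangentConeIdeal (fun i => algebraMap A (AdicCompletion (maximalIdeal A) A) (x i))
        (span_range_algebraMap_eq (map_maximalIdeal_adicCompletion A) x hx)) =
      directrixDim (tangentConeIdeal x hx) := by
  rw [tangentConeIdeal_adicCompletion x hx]
  exact directrixDim_map_eq_of_bijective _ (AdicCompletion.residueField_map_bijective A) _

variable (A)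

/-- **`e(Â) = e(A)`**: the directrix of a noetherian local ring is not changed by completion
(CJS Lemma 2.27 (3): `Dir_{x̂}(X̂) ≅ Dir_x(X) ×_{k(x)} 𝔸^d` with `d = 0`; `e_{x̂} = e_x`).
[cite: CossartJannsenSaito2020, Lemma 2.27 (3)] -/
theorem dirDim_adicCompletion : dirDim (AdicCompletion (maximalIdeal A) A) = dirDim A := by
  -- the images of the minimal generators of `𝔪` are minimal generators of `𝔪_Â`
  rw [dirDim_eq A (minGenerators A) (span_range_minGenerators A),
    dirDim_eq' (AdicCompletion (maximalIdeal A) A) (spanFinrank_maximalIdeal_adicCompletion A) _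
      (span_range_algebraMap_eq (map_maximalIdeal_adicCompletion A) _ (span_range_minGenerators A)),
    directrixDim_tangentConeIdeal_adicCompletion (minGenerators A) (span_range_minGenerators A)]

/-- **`e(Â)_K = e(A)_K`** for a common extension field `K` of the residue fields (`k(A) → k(Â) → K`).
[cite: CossartJannsenSaito2020, Lemma 2.27 (3)] -/
theorem dirDimOver_adicCompletion (K : Type v) [Field K] [Algebra (ResidueField A) K]
    [Algebra (ResidueField (AdicCompletion (maximalIdeal A) A)) K]
    (hK : (algebraMap (ResidueField (AdicCompletion (maximalIdeal A) A)) K).comp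
      (ResidueField.map (algebraMap A (AdicCompletion (maximalIdeal A) A))) =
        algebraMap (ResidueField A) K) :
    dirDimOver (AdicCompletion (maximalIdeal A) A) K = dirDimOver A K := by
  rw [dirDimOver_eq A K (minGenerators A) (span_range_minGenerators A),
    dirDimOver_eq' (AdicCompletion (maximalIdeal A) A) K (spanFinrank_maximalIdeal_adicCompletion A) _
      (span_range_algebraMap_eq (map_maximalIdeal_adicCompletion A) _ (span_range_minGenerators A)),
    tangentConeIdeal_adicCompletion (minGenerators A) (span_range_minGenerators A), Ideal.map_map]
  congr 2
  refine RingHom.ext fun p => ?_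
  rw [RingHom.comp_apply, MvPolynomial.map_map, hK]

/-- **`e(A)_K` does not depend on the model of `K`**: isomorphic extensions `K ≅_k K'` of the
residue field give the same `e(A)_K`. [cite: CossartJannsenSaito2020, Def. 2.18] -/
theorem dirDimOver_eq_of_algEquiv {K : Type v} {K' : Type*} [Field K] [Field K']
    [Algebra (ResidueField A) K] [Algebra (ResidueField A) K'] (φ : K ≃ₐ[ResidueField A] K') :
    dirDimOver A K' = dirDimOver A K := by
  unfold dirDimOver
  have h : algebraMap (ResidueField A) K' = (φ : K →+* K').comp (algebraMap (ResidueField A) K) :=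
    RingHom.ext fun a => (φ.commutes a).symm
  have hmap : (MvPolynomial.map (algebraMap (ResidueField A) K') :
      MvPolynomial (Fin (maximalIdeal A).spanFinrank) (ResidueField A) →+*
        MvPolynomial (Fin (maximalIdeal A).spanFinrank) K') =
      (MvPolynomial.map (φ : K →+* K')).comp (MvPolynomial.map (algebraMap (ResidueField A) K)) := by
    refine RingHom.ext fun p => ?_
    rw [RingHom.comp_apply, MvPolynomial.map_map, ← h]
  rw [hmap, ← Ideal.map_map]
  exact directrixDim_map_eq_of_bijective _ φ.bijective _

/-- **`ē(A) = e(A)_K` for every algebraic closure `K` of the residue field** (CJS Def. 2.21 does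
not depend on the algebraic closure). [cite: CossartJannsenSaito2020, Def. 2.21] -/
theorem geomDirDim_eq_dirDimOver (K : Type v) [Field K] [Algebra (ResidueField A) K]
    [IsAlgClosure (ResidueField A) K] : geomDirDim A = dirDimOver A K :=
  dirDimOver_eq_of_algEquiv A (IsAlgClosure.equiv (ResidueField A) K (AlgebraicClosure (ResidueField A)))

/-- **`ē(Â) = ē(A)`**: an algebraic closure of `k(Â)` is an algebraic closure of `k(A) ≅ k(Â)`, over
which both sides are `e(·)_K` (`dirDimOver_adicCompletion`, `geomDirDim_eq_dirDimOver`).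
[cite: CossartJannsenSaito2020, Lemma 2.27 (3)] -/
theorem geomDirDim_adicCompletion : geomDirDim (AdicCompletion (maximalIdeal A) A) = geomDirDim A := by
  -- `K = k̄(Â)` as an extension of `k(A)` through `κ : k(A) → k(Â)`
  letI alg : Algebra (ResidueField A) (AlgebraicClosure (ResidueField (AdicCompletion (maximalIdeal A) A))) :=
    ((algebraMap (ResidueField (AdicCompletion (maximalIdeal A) A))
      (AlgebraicClosure (ResidueField (AdicCompletion (maximalIdeal A) A)))).comp
      (ResidueField.map (algebraMap A (AdicCompletion (maximalIdeal A) A)))).toAlgebra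
  letI algκ : Algebra (ResidueField A) (ResidueField (AdicCompletion (maximalIdeal A) A)) :=
    (ResidueField.map (algebraMap A (AdicCompletion (maximalIdeal A) A))).toAlgebra
  haveI : IsScalarTower (ResidueField A) (ResidueField (AdicCompletion (maximalIdeal A) A))
      (AlgebraicClosure (ResidueField (AdicCompletion (maximalIdeal A) A))) :=
    IsScalarTower.of_algebraMap_eq fun _ => rfl
  -- `k(Â)` is algebraic over `k(A)` (the map is bijective), hence so is `K`
  haveI : Algebra.IsIntegral (ResidueField A) (ResidueField (AdicCompletion (maximalIdeal A) A)) :=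
    ⟨fun y => by
      obtain ⟨a, rfl⟩ := (AdicCompletion.residueField_map_bijective A).2 y
      exact isIntegral_algebraMap⟩
  haveI : Algebra.IsAlgebraic (ResidueField A) (ResidueField (AdicCompletion (maximalIdeal A) A)) :=
    Algebra.IsIntegral.isAlgebraic
  haveI : Algebra.IsAlgebraic (ResidueField A)
      (AlgebraicClosure (ResidueField (AdicCompletion (maximalIdeal A) A))) :=
    Algebra.IsAlgebraic.trans (ResidueField A) (ResidueField (AdicCompletion (maximalIdeal A) A)) _
  haveI : IsAlgClosure (ResidueField A) (AlgebraicClosure (ResidueField (AdicCompletion (maximalIdeal A) A))) :=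
    { isAlgClosed := inferInstance
      isAlgebraic := inferInstance }
  rw [geomDirDim, dirDimOver_adicCompletion A _ rfl, ← geomDirDim_eq_dirDimOver]

end Literature.RingTheory.HilbertSamuel

end
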